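import Literature.AnabelianGeometry.EtaleTheta.FrobenioidThetaDivisorSupportQModel
import Literature.AnabelianGeometry.EtaleTheta.FrobenioidThetaDivisorSupportQProp53

/-!
# [EtTh] §5, Proposition 5.3 (i)–(vi) at the PRODUCT chain model THROUGH the perfect-`Φ` capstone: all binders of
# `geometryOfDivisorsPreserved_of_principalQ` are JOINTLY SATISFIED at a perfect-`Φ` datum with non-trivial `Ψ` and `Aut_C(A_⊚)`-action
(non-vacuity certificate for the hypotheses of the `Q` assembly)

Mochizuki, *The étale theta function …*, Publ. RIMS **45** (2009)
[cite: MochizukiEtTh2009, Prop 5.3 p.325–327 (PDF pp.99–101); §1 p.238–240 (PDF pp.12–14); Prop 1.4 (i) p.247 (PDF p.21)].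
Seat abc-iut-L6-d1 (gen 4).  PROOF-ONLY over this seat's product chain model `FrobenioidThetaDivisorSupportQModel.lean`
(`prodTheta`, `prodPrimeData`, `supportDataQ`: `Φ(A_⊚) = ∏_{ℤ ⊔ ℤ} ℚ_{≥0}` PERFECT, `Aut_C(A_⊚) ≅ ℤ` translating the chain,
F1 = the degree-`0` integral lattice) and the `Q` assembly `FrobenioidThetaDivisorSupportQProp53.lean`; one plumbing `def`
(`prodTransport`, the transport stub "e is a chain automorphism", as in abc-iut-f-128's `chainTransport`).

WHAT IS PROVED, for every chain automorphism `e = reindexP (chainAut ε c)` (`ε = ±1`, `c ∈ ℤ`; `Ψ = 𝟭`, `ι = 𝟙`):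
* the transport of orders along a re-indexing (`ord_gpMap_reindexP`) and of the degree on a component
  (`degOn_gpMap_reindexP`: translations and reflections of the chain permute the four-term degree formula);
* EVERY binder of `DivisorSupportDataQ.geometryOfDivisorsPreserved_of_principalQ` at `supportDataQ`: F1-Ψ (`hP_reindexP`),
  F1-Aut (`hAP_prod`), cusp-Aut (`hAc_prod`), (i) (`preservesCuspidality_prod`), the integral binder (from the model file),
  `hdiv` with the profile `θ = 0` (`hdiv_prod`);
* hence `geometryOfDivisorsPreserved_prod`: [EtTh] Prop. 5.3 (i)–(vi) at the product chain model, obtained BY APPLYING the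
  perfect-`Φ` capstone — so the capstone's hypotheses are simultaneously satisfiable at a datum meeting Prop. 5.1's
  "`Φ(−)` perfect", with `e ≠ id` and a non-degenerate `Aut_C(A_⊚)`-orbit of `div(Θ̈)`.
HONEST FRAMING: a toy datum; nothing about the tempered Frobenioid of [EtTh] §5 or [IUTchIII] Cor. 3.12; no side taken;
typed ≠ proved; non-vacuity ≠ discharge. -/

noncomputable section

namespace Literature.AnabelianGeometry.EtaleTheta.FrobenioidThetaDivisors.QProdChain

open CategoryTheory Literature.AlgebraicGeometry.Frobenioids ConstantMultiple ConstantMultiple.Cor512Toy Prop53Toy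
  Prop53Chain

/-! ### Transport of orders and degrees along a re-indexing -/

/-- `ord_{P j} (e^gp x) = ord_{P (σ⁻¹ j)} x` for `e = reindexP σ`. [cite: MochizukiEtTh2009, Prop 5.3 proof p.326 (PDF p.100)] -/
theorem ord_gpMap_reindexP (σ : Idx ≃ Idx) (j : Idx) (x : Algebra.GrothendieckGroup prodTheta.PhiAcirc) :
    supportDataQ₀.ord (Pp j) (ThetaFrobenioid.gpMap (reindexP σ).toMonoidHom x) = supportDataQ₀.ord (Pp (σ.symm j)) x := by
  have key : (supportDataQ₀.ordGp (Pp j)).comp (ThetaFrobenioid.gpMap (reindexP σ).toMonoidHom) =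
      supportDataQ₀.ordGp (Pp (σ.symm j)) :=
    DivisorSupportData.gpHom_ext fun a => by
      apply Multiplicative.toAdd.injective
      rw [MonoidHom.comp_apply, ThetaFrobenioid.gpMap_of, MulEquiv.coe_toMonoidHom]
      change supportDataQ₀.ord (Pp j) (Algebra.GrothendieckGroup.of (reindexP σ a)) =
        supportDataQ₀.ord (Pp (σ.symm j)) (Algebra.GrothendieckGroup.of a)
      rw [ord₀_of, ord₀_of, idxP_Pp, idxP_Pp]
      rfl
  have := DFunLike.congr_fun key x
  simp only [DivisorSupportDataQ.ord, ← this, MonoidHom.comp_apply]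

/-- The prime `P (inl n)` as a non-cuspidal prime. [cite: MochizukiEtTh2009, Prop 5.3 p.325 (PDF p.99)] -/
def ncspOf (n : ℤ) : {p : Primes prodTheta.PhiAcirc // ¬ prodPrimeData.IsCuspidal p} := ⟨Pp (Sum.inl n), not_isCuspP_inl n⟩

/-- Every non-cuspidal prime is `ncspOf (label 𝔫)`. [cite: MochizukiEtTh2009, Prop 5.3 (v) p.325 (PDF p.99)] -/
theorem ncspOf_labelP (𝔫 : {p : Primes prodTheta.PhiAcirc // ¬ prodPrimeData.IsCuspidal p}) : ncspOf (labelP 𝔫.1) = 𝔫 :=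
  Subtype.ext (Pp_inl_labelP 𝔫.2)

/-- The neighbours of `ncspOf n` are `ncspOf (n + t)`. [cite: MochizukiEtTh2009, §1 p.239–240 (PDF pp.13–14)] -/
theorem ncspShift_ncspOf (t n : ℤ) : ncspShift prodPrimeData t (ncspOf n) = ncspOf (n + t) := by
  apply prodPrimeData.ncspEquivZ.injective
  rw [ncspEquivZ_ncspShift]
  change labelP (Pp (Sum.inl n)) + t = labelP (Pp (Sum.inl (n + t)))
  rw [labelP_inl, labelP_inl]

/-- The cusp over `ncspOf n` is `P (inr n)`. [cite: MochizukiEtTh2009, Prop 5.3 (iv) p.325 (PDF p.99)] -/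
theorem cuspOver_ncspOf (n : ℤ) : ((cuspOver (ncspOf n)).1 : Primes prodTheta.PhiAcirc) = Pp (Sum.inr n) := by
  change Pp (Sum.inr (labelP (Pp (Sum.inl n)))) = Pp (Sum.inr n)
  rw [labelP_inl]

/-- **The degree on a component, at the model**: the four-term formula at `ncspOf n`.
[cite: MochizukiEtTh2009, §1 p.240 (PDF p.14)] -/
theorem degOn₀_ncspOf (n : ℤ) (x : Algebra.GrothendieckGroup prodTheta.PhiAcirc) :
    supportDataQ₀.degOn (ncspOf n) x =
      supportDataQ₀.ord (Pp (Sum.inl (n + -1))) x - 2 * supportDataQ₀.ord (Pp (Sum.inl n)) x +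
        supportDataQ₀.ord (Pp (Sum.inl (n + 1))) x + supportDataQ₀.ord (Pp (Sum.inr n)) x := by
  rw [degOn₀_eq, ncspShift_ncspOf, ncspShift_ncspOf, cuspOver_ncspOf]
  rfl

/-- **Transport of the degree along a chain automorphism**: `deg_{n_j}(e^gp x) = deg_{n_{ε(j−c)}}(x)` for
`e = reindexP (chainAut ε c)` (a reflection swaps the two neighbours; the formula is symmetric in them).
[cite: MochizukiEtTh2009, §1 p.238–240 (PDF pp.12–14)] -/
theorem degOn_gpMap_reindexP (ε : ℤˣ) (c n : ℤ) (x : Algebra.GrothendieckGroup prodTheta.PhiAcirc) :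
    supportDataQ₀.degOn (ncspOf n) (ThetaFrobenioid.gpMap (reindexP (chainAut ε c)).toMonoidHom x) =
      supportDataQ₀.degOn (ncspOf (ε * (n - c))) x := by
  rw [degOn₀_ncspOf, degOn₀_ncspOf, ord_gpMap_reindexP, ord_gpMap_reindexP, ord_gpMap_reindexP, ord_gpMap_reindexP,
    chainAut_symm_inl, chainAut_symm_inl, chainAut_symm_inl, chainAut_symm_inr]
  rcases Int.units_eq_one_or ε with rfl | rfl
  · simp only [Units.val_one, one_mul]
    have e1 : n + -1 - c = n - c + -1 := by ring
    have e2 : n + 1 - c = n - c + 1 := by ring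
    rw [e1, e2]
  · simp only [Units.val_neg, Units.val_one, neg_mul, one_mul]
    have e1 : -(n + -1 - c) = -(n - c) + 1 := by ring
    have e2 : -(n + 1 - c) = -(n - c) + -1 := by ring
    rw [e1, e2]
    ring

/-- Integrality is transported along a re-indexing. [cite: MochizukiEtTh2009, Prop 3.2 (i) p.296 (PDF p.70)] -/
theorem integral_gpMap_reindexP_iff (σ : Idx ≃ Idx) (x : Algebra.GrothendieckGroup prodTheta.PhiAcirc) :
    supportDataQ₀.Integral (ThetaFrobenioid.gpMap (reindexP σ).toMonoidHom x) ↔ supportDataQ₀.Integral x := by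
  constructor
  · intro h 𝔭
    obtain ⟨z, hz⟩ := h (Pp (σ (idxP 𝔭)))
    rw [ord_gpMap_reindexP, Equiv.symm_apply_apply, Pp_idxP] at hz
    exact ⟨z, hz⟩
  · intro h 𝔭
    obtain ⟨z, hz⟩ := h (Pp (σ.symm (idxP 𝔭)))
    refine ⟨z, ?_⟩
    rw [← Pp_idxP 𝔭, ord_gpMap_reindexP]
    exact hz

/-- **F1-`e` at the model**: a chain automorphism `e^gp` preserves the degree-`0` integral lattice (`iff`).
[cite: MochizukiEtTh2009, Prop 5.3 proof p.326 (PDF p.100)] -/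
theorem hP_reindexP (ε : ℤˣ) (c : ℤ) (x : Algebra.GrothendieckGroup prodTheta.PhiAcirc) :
    ThetaFrobenioid.gpMap (reindexP (chainAut ε c)).toMonoidHom x ∈ supportDataQ.principal ↔ x ∈ supportDataQ.principal := by
  change (supportDataQ₀.Integral _ ∧ ∀ 𝔫, supportDataQ₀.degOn 𝔫 _ = 0) ↔ (supportDataQ₀.Integral x ∧ ∀ 𝔫, supportDataQ₀.degOn 𝔫 x = 0)
  rw [integral_gpMap_reindexP_iff]
  refine and_congr_right fun _ => ⟨fun h 𝔫 => ?_, fun h 𝔫 => ?_⟩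
  · -- `𝔫 = ncspOf m` with `m = ε(n - c)` for `n := ε m + c`
    have hm := h (ncspOf (ε * labelP 𝔫.1 + c))
    rw [degOn_gpMap_reindexP] at hm
    have : (ε : ℤ) * (ε * labelP 𝔫.1 + c - c) = labelP 𝔫.1 := by
      rw [add_sub_cancel_right, ← mul_assoc, Int.units_coe_mul_self, one_mul]
    rwa [this, ncspOf_labelP] at hm
  · rw [← ncspOf_labelP 𝔫, degOn_gpMap_reindexP]
    exact h _

/-! ### The binders of the perfect-`Φ` capstone at the model -/

/-- `ι := 𝟙 : Ψ(A_⊚) = A_⊚ ⥲ A_⊚` for `Ψ = 𝟭` at the product model. [cite: MochizukiEtTh2009, Prop 5.3 p.325 (PDF p.99)] -/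
abbrev ιP : Ψ₁.functor.obj prodTheta.Acirc ≅ prodTheta.Acirc := Iso.refl pt

/-- `Ψ^Φ_{A_⊚} = e` at the model (`Ψ = 𝟭`, `ι = 𝟙`). [cite: MochizukiEtTh2009, Prop 5.3 p.325 (PDF p.99)] -/
theorem psiPhi_prod (e : prodTheta.PhiAcirc ≃* prodTheta.PhiAcirc) : psiPhi prodTheta Ψ₁ ιP e = e :=
  MulEquiv.ext fun a => prodTheta.pre.pull_id _ (e a)

/-- A chain automorphism preserves cuspidality of primes. [cite: MochizukiEtTh2009, Prop 5.3 (i) p.325 (PDF p.99)] -/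
theorem isCuspP_congr_reindexP (ε : ℤˣ) (c : ℤ) (𝔭 : Primes prodTheta.PhiAcirc) :
    prodPrimeData.IsCuspidal (Primes.congr (reindexP (chainAut ε c)) 𝔭) ↔ prodPrimeData.IsCuspidal 𝔭 := by
  change IsCuspP _ ↔ IsCuspP _
  constructor
  · rintro ⟨m, hm⟩
    rw [idxP_congr_reindexP] at hm
    rcases h : idxP 𝔭 with n | n
    · rw [h, chainAut_inl] at hm; exact absurd hm Sum.inl_ne_inr
    · exact ⟨n, h⟩
  · rintro ⟨n, hn⟩
    exact ⟨ε * n + c, by rw [idxP_congr_reindexP, hn, chainAut_inr]⟩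

/-- `pullAut g` is the translation by `g⁻¹`. [cite: MochizukiEtTh2009, Prop 5.3 (vi) p.326 (PDF p.100)] -/
theorem pullAut_eq_reindexP (g : Aut prodTheta.Acirc) :
    prodTheta.pullAut g = reindexP (chainAut 1 (Multiplicative.toAdd g.inv)) :=
  MulEquiv.ext fun _ => rfl

/-- **cusp-Aut at the model**: every `g ∈ Aut_C(A_⊚)` preserves the cuspidal primes.
[cite: MochizukiEtTh2009, §1 p.238 (PDF p.12)] -/
theorem hAc_prod (g : Aut prodTheta.Acirc) (𝔭 : Primes prodTheta.PhiAcirc) :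
    prodPrimeData.IsCuspidal (Primes.congr (prodTheta.pullAut g) 𝔭) ↔ prodPrimeData.IsCuspidal 𝔭 := by
  rw [pullAut_eq_reindexP]; exact isCuspP_congr_reindexP 1 _ 𝔭

/-- **F1-Aut at the model**: every `g ∈ Aut_C(A_⊚)` preserves the degree-`0` integral lattice.
[cite: MochizukiEtTh2009, Prop 5.3 (vi) p.326 (PDF p.100)] -/
theorem hAP_prod (g : Aut prodTheta.Acirc) (x : Algebra.GrothendieckGroup prodTheta.PhiAcirc) :
    ThetaFrobenioid.gpMap (prodTheta.pullAut g).toMonoidHom x ∈ supportDataQ.principal ↔ x ∈ supportDataQ.principal := by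
  rw [pullAut_eq_reindexP]; exact hP_reindexP 1 _ x

/-- **`hdiv` at the model with the profile `θ = 0`**: `div(Θ̈)` has order `0` on every component.
[cite: MochizukiEtTh2009, Prop 1.4 (i) p.247 (PDF p.21)] -/
theorem hdiv_prod (𝔫 : Primes prodTheta.PhiAcirc) (h𝔫 : ¬ prodPrimeData.IsCuspidal 𝔫) :
    supportDataQ.ord 𝔫 prodPrimeData.divTheta = (fun _ : ℤ => (0 : ℚ)) (prodPrimeData.ncspEquivZ ⟨𝔫, h𝔫⟩) := by
  obtain ⟨n, hn⟩ := idxP_eq_inl_of_not_isCuspP h𝔫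
  change supportDataQ₀.ord 𝔫 (Algebra.GrothendieckGroup.of divThetaP) = 0
  rw [ord₀_of, hn]
  change ((Multiplicative.toAdd (1 : Multiplicative NNRat) : ℚ≥0) : ℚ) = 0
  rw [toAdd_one, NNRat.coe_zero]

/-- If `e` respects a property `Q` of primes, then "`a` lies only in `Q`-primes" iff "`e a` does" ((i) on elements from (i) on
primes; f-128's `forall_mem_carrier_congr` for the product). [cite: MochizukiEtTh2009, Prop 5.3 (i) p.325 (PDF p.99)] -/
theorem forall_mem_carrier_congrP {ψ : prodTheta.PhiAcirc ≃* prodTheta.PhiAcirc} {Q : Primes prodTheta.PhiAcirc → Prop}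
    (hψ : ∀ 𝔭, Q (Primes.congr ψ 𝔭) ↔ Q 𝔭) (a : prodTheta.PhiAcirc) :
    (∀ 𝔭 : Primes prodTheta.PhiAcirc, a ∈ 𝔭.carrier → Q 𝔭) ↔ ∀ 𝔮 : Primes prodTheta.PhiAcirc, ψ a ∈ 𝔮.carrier → Q 𝔮 := by
  constructor
  · intro h 𝔮 h𝔮
    rw [← Primes.congr_apply_congr_symm ψ 𝔮, Primes.mem_carrier_congr_iff, ψ.symm_apply_apply] at h𝔮
    rw [← Primes.congr_apply_congr_symm ψ 𝔮]
    exact (hψ _).mpr (h _ h𝔮)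
  · intro h 𝔭 h𝔭
    have h' : ψ a ∈ (Primes.congr ψ 𝔭).carrier := by rw [Primes.mem_carrier_congr_iff, ψ.symm_apply_apply]; exact h𝔭
    exact (hψ 𝔭).mp (h _ h')

/-- **The transport stub of the product chain model**: `e` "is induced by `Ψ`" iff it re-indexes along a chain automorphism.
[cite: MochizukiEtTh2009, Prop 5.3 p.325 (PDF p.99)] -/
def prodTransport : DivisorTransportStub prodTheta where
  IsInducedBy := fun _ _ e => ∃ (ε : ℤˣ) (c : ℤ), ∀ a, e a = reindexP (chainAut ε c) a

/-- **(i) at the model**: a chain automorphism preserves non-cuspidal and cuspidal elements and primes.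
[cite: MochizukiEtTh2009, Prop 5.3 (i) p.325 (PDF p.99)] -/
theorem preservesCuspidality_prod (ε : ℤˣ) (c : ℤ) :
    Literature.AnabelianGeometry.EtaleTheta.FrobenioidThetaDivisors.PreservesCuspidality prodTransport prodPrimeData Ψ₁ ιP
      (reindexP (chainAut ε c)) := by
  intro _
  have hc : ∀ 𝔭, prodPrimeData.IsCuspidal (Primes.congr (psiPhi prodTheta Ψ₁ ιP (reindexP (chainAut ε c))) 𝔭) ↔
      prodPrimeData.IsCuspidal 𝔭 := fun 𝔭 => by rw [psiPhi_prod]; exact isCuspP_congr_reindexP ε c 𝔭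
  refine ⟨fun a => ?_, fun a => ?_, hc⟩
  · exact forall_mem_carrier_congrP (Q := fun 𝔭 => ¬ prodPrimeData.IsCuspidal 𝔭) (fun 𝔭 => not_congr (hc 𝔭)) a
  · exact forall_mem_carrier_congrP (Q := prodPrimeData.IsCuspidal) hc a

/-- **[EtTh] Prop. 5.3 (i)–(vi) at the product chain model, THROUGH the perfect-`Φ` capstone**: every hypothesis of
`DivisorSupportDataQ.geometryOfDivisorsPreserved_of_principalQ` holds at `supportDataQ` for `e = reindexP (chainAut ε c)`.
[cite: MochizukiEtTh2009, Prop 5.3 p.325–327 (PDF pp.99–101)] -/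
theorem geometryOfDivisorsPreserved_prod (ε : ℤˣ) (c : ℤ) :
    Literature.AnabelianGeometry.EtaleTheta.FrobenioidThetaDivisors.GeometryOfDivisorsPreserved prodTransport prodPrimeData
      Ψ₁ ιP (reindexP (chainAut ε c)) :=
  supportDataQ.geometryOfDivisorsPreserved_of_principalQ Ψ₁ ιP (reindexP (chainAut ε c)) prodTransport ⟨ε, c, fun _ => rfl⟩
    (preservesCuspidality_prod ε c)
    (fun x => by rw [psiPhi_prod]; exact hP_reindexP ε c x)
    principalIffIntegralDegreeZero_supportDataQ (fun _ => 0) 0 (fun _ => rfl) hdiv_prod hAc_prod hAP_prod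

/-- **Every `e` admitted by the transport stub satisfies Prop. 5.3 (i)–(vi)** at the product chain model, via the capstone.
[cite: MochizukiEtTh2009, Prop 5.3 p.325–326 (PDF pp.99–100)] -/
theorem geometryOfDivisorsPreserved_prod_of_isInducedBy
    (e : prodTheta.PhiAcirc ≃* prodTheta.pre.Mon (prodTheta.base.obj (Ψ₁.functor.obj prodTheta.Acirc)))
    (he : prodTransport.IsInducedBy Ψ₁ prodTheta.Acirc e) :
    Literature.AnabelianGeometry.EtaleTheta.FrobenioidThetaDivisors.GeometryOfDivisorsPreserved prodTransport prodPrimeData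
      Ψ₁ ιP e := by
  obtain ⟨ε, c, h⟩ := he
  obtain rfl : e = reindexP (chainAut ε c) := MulEquiv.ext h
  exact geometryOfDivisorsPreserved_prod ε c

end Literature.AnabelianGeometry.EtaleTheta.FrobenioidThetaDivisors.QProdChain

end
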